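import Summits.Ventures.HodgeRepro2.T6N43Hyp
import Summits.Ventures.HodgeRepro2.T5CoshIntegral
import Summits.Ventures.HodgeRepro2.T5CompactFactor

/-!
# T6N43Main — THEOREM N4.3 in kernel: `N43_main_U11` (τ′₂, τ′₃) and `N43_main_U2` (τ′₁)

Record: TIER5 §N4.3 THEOREM N4.3 (a)–(c) (route/T5-N4-p5.md v13, TIER5 v0.51 fbbb58a4… ll. 1249–1251) and its proof
(N4.3.P1)–(P4). Over the datum of T6N43Datum.lean, modulo the displays of T6N43Hyp.lean consumed BY
NAME and the interface Props (N4.3.P2) / (N4.3.P2′) as binders (ruling STATUS l. 4414 (q4)):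
(a) `zeta 𝒟 (1/2)` is the absolutely convergent integral `∫ ⟨ω(g)φ,φ⟩ · conj⟨π₀(g)f,f⟩ dg`
    (`zeta_half`, `zeta_integrable_at_half`);
(b) its value is `‖φ‖² ‖f‖² · c_j > 0` — `c_1 = 1` (`zeta_half_eq_U2`), `c_j = c/2` with c the
    normalisation constant of the (A-2f) display (`zeta_half_eq_U11`; p1's
    `T5CoshIntegral.ruhl_measure_integral_two` = the route's ∫ cosh(η/2)^{−6} dμ = 1/2);
(c) `zetaStar 𝒟 (1/2) ≠ 0` (`N43_main_U11`, `N43_main_U2`; the L-factor at s = 1 is a product of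
    Γ_ℂ(1 + |x|) ≠ 0 — `GammaC_ne_zero_of_re_pos`, `Lfac_one_ne_zero`).
The M2 consumer (the lead's `periodInputN_of_published`, l. 4414 (q1)) reads `∀ j, Z^*_j(1/2) ≠ 0`
off the two mains. Axioms: {propext, Classical.choice, Quot.sound}. §8(d): uses an L-value-free
non-vanishing device: NO.
-/

namespace Summit.Ventures.HodgeRepro2.T6

open MeasureTheory Complex
open scoped NNReal ENNReal

/-- `Γ_ℂ(z) = 2(2π)^{−z}Γ(z) ≠ 0` for `Re z > 0` (p1's `T5GammaFactor.GammaC`; Mathlib's `Gamma` has no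
zeros on `Re z > 0`). -/
theorem GammaC_ne_zero_of_re_pos {z : ℂ} (hz : 0 < z.re) : T5GammaFactor.GammaC z ≠ 0 := by
  unfold T5GammaFactor.GammaC
  exact mul_ne_zero (mul_ne_zero two_ne_zero (T5GammaFactor.two_pi_cpow_ne_zero z))
    (Complex.Gamma_ne_zero_of_re_pos hz)

/-- (N4.3.P4)(α): the displayed archimedean L-factor (Eischen–Liu §2.2 shape) does not vanish at
`s = 1` — every factor is `Γ_ℂ(1 + |x|)` with `1 + |x| > 0`. -/
theorem Lfac_one_ne_zero {a b : ℕ} {τ : Fin a → ℤ} {ν : Fin b → ℤ} {r : ℤ} {L : ℂ → ℂ}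
    (hEL : Hyp.EischenLiu2024_Sec2_2 a b τ ν r L) : L 1 ≠ 0 := by
  rw [hEL 1]
  refine mul_ne_zero ?_ ?_
  · rw [Finset.prod_ne_zero_iff]
    intro j _
    apply GammaC_ne_zero_of_re_pos
    simp only [add_re, one_re, ofReal_re]
    positivity
  · rw [Finset.prod_ne_zero_iff]
    intro j _
    apply GammaC_ne_zero_of_re_pos
    simp only [add_re, one_re, ofReal_re]
    positivity

namespace ArchDoublingDatum

variable {H : Type*} [MeasurableSpace H] {P : Matrix (Fin 2) (Fin 2) ℂ → Prop}

/-- Rühl's parameter `η(g) = 2 arsinh ‖g₁₀‖` is a measurable function on `H`. -/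
theorem measurable_eta (𝒟 : ArchDoublingDatum H P) : Measurable 𝒟.eta := by
  unfold eta
  exact (Real.continuous_arsinh.measurable.comp ((𝒟.rep_measurable 1 0).norm)).const_mul 2

/-- THEOREM N4.3 (a), the shape: at `s = s_{m,n} = 1/2` the section factor `|a(i(g,1))|^{s − 1/2}` is 1
and `Z(1/2) = ∫_H ⟨ω(g)φ, φ⟩ · \overline{⟨π₀(g)f, f⟩} dg` (TIER5 v0.51 l. 1250). -/
theorem zeta_half (𝒟 : ArchDoublingDatum H P) :
    𝒟.zeta (1 / 2) = ∫ g, 𝒟.coeffW g * (starRingEnd ℂ) (𝒟.coeffπ g) ∂𝒟.μ := by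
  unfold zeta
  simp only [sub_self, cpow_zero, mul_one]

/-- (N4.3.P3), the integrand: under the Fock-line identification (N4.3.P2) the integrand of `Z(1/2)`
is the non-negative real function `(‖φ‖²/‖f‖²) · |⟨π₀(g)f, f⟩|²` (TIER5 v0.51 l. 1303). -/
theorem integrand_eq (𝒟 : ArchDoublingDatum H P) (hP2 : 𝒟.FockLineIdentification) (g : H) :
    𝒟.coeffW g * (starRingEnd ℂ) (𝒟.coeffπ g) =
      (((𝒟.normφ ^ 2 / 𝒟.normf ^ 2) * ‖𝒟.coeffπ g‖ ^ 2 : ℝ) : ℂ) := by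
  rw [hP2 g, mul_assoc, Complex.mul_conj, Complex.normSq_eq_norm_sq]
  push_cast
  ring

/-- The radial integration formula of the (A-2f) display: for every measurable `F : ℝ → ℝ`,
`∫_H F(η(g)) dg = c · ∫_0^∞ F(η) · ½ sinh η dη`. -/
theorem integral_eta (𝒟 : ArchDoublingDatum H T5UnitaryBound.MemU11) (hA : Hyp.Ruhl1970_A2f 𝒟)
    {F : ℝ → ℝ} (hF : Measurable F) :
    ∃ c : ℝ, 0 < c ∧ ∫ g, F (𝒟.eta g) ∂𝒟.μ =
      c * ∫ η in Set.Ioi (0 : ℝ), (1 / 2 * Real.sinh η) * F η := by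
  obtain ⟨c, hc, hmap⟩ := hA
  refine ⟨c, hc, ?_⟩
  have h1 : ∫ g, F (𝒟.eta g) ∂𝒟.μ = ∫ η, F η ∂(Measure.map 𝒟.eta 𝒟.μ) :=
    (integral_map 𝒟.measurable_eta.aemeasurable hF.aestronglyMeasurable).symm
  rw [h1, hmap, integral_smul_measure, ENNReal.toReal_ofReal hc.le, smul_eq_mul]
  congr 1
  have h2 : (fun η : ℝ => ENNReal.ofReal (1 / 2 * Real.sinh η)) =
      fun η : ℝ => ((Real.toNNReal (1 / 2 * Real.sinh η) : ℝ≥0) : ℝ≥0∞) := rfl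
  have hmeas : Measurable fun η : ℝ => Real.toNNReal (1 / 2 * Real.sinh η) :=
    (Real.measurable_sinh.const_mul (1 / 2)).real_toNNReal
  rw [h2, integral_withDensity_eq_integral_smul hmeas F]
  refine setIntegral_congr_fun measurableSet_Ioi (fun η hη => ?_)
  simp only [NNReal.smul_def, smul_eq_mul]
  rw [Real.coe_toNNReal _ (by
    have : 0 < Real.sinh η := Real.sinh_pos_iff.mpr hη
    positivity)]

/-- Pointwise: `|⟨π₀(g)f, f⟩|² = ‖f‖⁴ · cosh(η/2)^{−6}` under (N4.3.P2′). -/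
theorem normSq_coeffπ (𝒟 : ArchDoublingDatum H P) (hP2' : 𝒟.LowestWeightCoefficient) (g : H) :
    ‖𝒟.coeffπ g‖ ^ 2 = 𝒟.normf ^ 4 * Real.cosh (𝒟.eta g / 2) ^ (-6 : ℤ) := by
  have h1 : (Real.cosh (𝒟.eta g / 2) ^ (-3 : ℤ)) ^ 2 = Real.cosh (𝒟.eta g / 2) ^ (-6 : ℤ) := by
    rw [← zpow_natCast, ← zpow_mul]
    norm_num
  rw [hP2' g, mul_pow, h1]
  ring

/-- The radial integrand of (N4.3.P2′)/(P3) in p1's form: `½ sinh η · cosh(η/2)^{−6}`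
= `½ sinh η · cosh(½η)^{−3·2}` (real power). -/
theorem radial_integrand_eq (η : ℝ) :
    (1 / 2 * Real.sinh η) * Real.cosh (η / 2) ^ (-6 : ℤ) =
      1 / 2 * Real.sinh η * Real.cosh (1 / 2 * η) ^ (-(3 * 2) : ℝ) := by
  rw [show η / 2 = 1 / 2 * η by ring, show (-(3 * 2) : ℝ) = ((-6 : ℤ) : ℝ) by norm_num,
    Real.rpow_intCast]

/-- THEOREM N4.3 (b) at τ′₂, τ′₃: `Z(1/2) = ‖φ‖² ‖f‖² · c/2` for the constant `c > 0` of the (A-2f)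
display (TIER5 v0.51 l. 1251: «c_j = ∫_{U(1,1)} cosh(η(g)/2)^{−6} dg, an explicit positive number
(= vol(Z_j)/2 when the SU(1,1)-factor carries Rühl's measure)»; the integral is p1's
`T5CoshIntegral.ruhl_measure_integral_two` = 1/2). -/
theorem zeta_half_eq_U11 (𝒟 : ArchDoublingDatum H T5UnitaryBound.MemU11)
    (hP2 : 𝒟.FockLineIdentification) (hP2' : 𝒟.LowestWeightCoefficient)
    (hA2f : Hyp.Ruhl1970_A2f 𝒟) :
    ∃ c : ℝ, 0 < c ∧ 𝒟.zeta (1 / 2) = ((𝒟.normφ ^ 2 * 𝒟.normf ^ 2 * (c * (1 / 2)) : ℝ) : ℂ) := by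
  have hF : Measurable fun η : ℝ => Real.cosh (η / 2) ^ (-6 : ℤ) :=
    ((Real.continuous_cosh.comp (continuous_id.div_const 2)).zpow₀ (-6)
      (fun _ => Or.inl (Real.cosh_pos _).ne')).measurable
  obtain ⟨c, hc, hint⟩ := 𝒟.integral_eta hA2f hF
  refine ⟨c, hc, ?_⟩
  have hnf : 𝒟.normf ≠ 0 := 𝒟.normf_pos.ne'
  -- the integrand as a real function of η(g)
  have hpt : ∀ g, 𝒟.coeffW g * (starRingEnd ℂ) (𝒟.coeffπ g) =
      (((𝒟.normφ ^ 2 * 𝒟.normf ^ 2) * Real.cosh (𝒟.eta g / 2) ^ (-6 : ℤ) : ℝ) : ℂ) := by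
    intro g
    rw [𝒟.integrand_eq hP2 g, 𝒟.normSq_coeffπ hP2' g]
    congr 1
    field_simp
  have hI : ∫ η in Set.Ioi (0 : ℝ), (1 / 2 * Real.sinh η) * Real.cosh (η / 2) ^ (-6 : ℤ) = 1 / 2 := by
    simp_rw [radial_integrand_eq]
    exact T5CoshIntegral.ruhl_measure_integral_two
  have hc1 : ∫ g, (((𝒟.normφ ^ 2 * 𝒟.normf ^ 2) * Real.cosh (𝒟.eta g / 2) ^ (-6 : ℤ) : ℝ) : ℂ) ∂𝒟.μ =
      ((∫ g, (𝒟.normφ ^ 2 * 𝒟.normf ^ 2) * Real.cosh (𝒟.eta g / 2) ^ (-6 : ℤ) ∂𝒟.μ : ℝ) : ℂ) :=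
    integral_ofReal
  rw [zeta_half]
  simp_rw [hpt]
  rw [hc1, integral_const_mul, hint, hI]

/-- THEOREM N4.3 (a)–(c) at the places τ′₂, τ′₃ (`H = U(1,1)`), modulo the displays
`Hyp.Ruhl1970_A2f` and `Hyp.EischenLiu2024_Sec2_2` (signature (a,b) = (1,1)) consumed by name and the
interface Props (N4.3.P2), (N4.3.P2′): `Z(1/2) > 0` and `Z^*(1/2) = Z(1/2)/L(1, π₀,τ′ × χ_V) ≠ 0`. -/
theorem N43_main_U11 (𝒟 : ArchDoublingDatum H T5UnitaryBound.MemU11)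
    (hP2 : 𝒟.FockLineIdentification) (hP2' : 𝒟.LowestWeightCoefficient)
    (hA2f : Hyp.Ruhl1970_A2f 𝒟) {τ ν : Fin 1 → ℤ} {r : ℤ}
    (hEL : Hyp.EischenLiu2024_Sec2_2 1 1 τ ν r 𝒟.Lfac) :
    0 < (𝒟.zeta (1 / 2)).re ∧ 𝒟.zetaStar (1 / 2) ≠ 0 := by
  obtain ⟨c, hc, hval⟩ := 𝒟.zeta_half_eq_U11 hP2 hP2' hA2f
  have hpos : 0 < (𝒟.zeta (1 / 2)).re := by
    rw [hval, ofReal_re]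
    have := 𝒟.normφ_pos
    have := 𝒟.normf_pos
    positivity
  refine ⟨hpos, ?_⟩
  unfold zetaStar
  rw [show (1 / 2 + 1 / 2 : ℂ) = 1 by norm_num]
  exact div_ne_zero (fun h => by rw [h] at hpos; simp at hpos) (Lfac_one_ne_zero hEL)

/-- THEOREM N4.3 (b) at the compact place τ′₁ (`H = U(2)` with the probability Haar measure):
`Z(1/2) = ‖φ‖² ‖f‖²` (TIER5 v0.51 l. 1251 «c_1 = 1»; p1's `T5CompactFactor.integral_normSq_det_zpow`). -/
theorem zeta_half_eq_U2 (𝒟 : ArchDoublingDatum H (· ∈ Matrix.unitaryGroup (Fin 2) ℂ))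
    (hμ : IsProbabilityMeasure 𝒟.μ) {m : ℤ} (hP2 : 𝒟.CharacterCoefficient m) :
    𝒟.zeta (1 / 2) = ((𝒟.normφ ^ 2 * 𝒟.normf ^ 2 : ℝ) : ℂ) := by
  obtain ⟨hW, hπ⟩ := hP2
  have hnf : 𝒟.normf ≠ 0 := 𝒟.normf_pos.ne'
  have hpt : ∀ g, 𝒟.coeffW g * (starRingEnd ℂ) (𝒟.coeffπ g) =
      ((𝒟.normφ ^ 2 / 𝒟.normf ^ 2 : ℝ) : ℂ) *
        ((‖(𝒟.rep g).det ^ m * ((𝒟.normf ^ 2 : ℝ) : ℂ)‖ ^ 2 : ℝ) : ℂ) := by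
    intro g
    rw [hW g, hπ g, ← Complex.normSq_eq_norm_sq, ← Complex.mul_conj]
    have key : ((𝒟.normφ ^ 2 / 𝒟.normf ^ 2 : ℝ) : ℂ) * ((𝒟.normf ^ 2 : ℝ) : ℂ) =
        ((𝒟.normφ ^ 2 : ℝ) : ℂ) := by
      rw [← Complex.ofReal_mul, div_mul_cancel₀ _ (pow_ne_zero 2 hnf)]
    rw [← key]
    ring
  have hc1 : ∫ g, ((‖(𝒟.rep g).det ^ m * ((𝒟.normf ^ 2 : ℝ) : ℂ)‖ ^ 2 : ℝ) : ℂ) ∂𝒟.μ =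
      ((∫ g, ‖(𝒟.rep g).det ^ m * ((𝒟.normf ^ 2 : ℝ) : ℂ)‖ ^ 2 ∂𝒟.μ : ℝ) : ℂ) :=
    integral_ofReal
  rw [zeta_half]
  simp_rw [hpt]
  rw [integral_const_mul, hc1, T5CompactFactor.integral_normSq_det_zpow 𝒟.μ 𝒟.rep 𝒟.rep_mem m,
    Complex.norm_real, Real.norm_eq_abs, abs_of_pos (pow_pos 𝒟.normf_pos 2), ← Complex.ofReal_mul]
  congr 1
  field_simp

/-- THEOREM N4.3 (a)–(c) at the compact place τ′₁ (`H = U(2)`, probability Haar measure), modulo the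
display `Hyp.EischenLiu2024_Sec2_2` (signature (a,b) = (2,0)) consumed by name and the interface Prop
(N4.3.P2) at τ′₁: `Z(1/2) = ‖φ‖²‖f‖² > 0` and `Z^*(1/2) ≠ 0`. -/
theorem N43_main_U2 (𝒟 : ArchDoublingDatum H (· ∈ Matrix.unitaryGroup (Fin 2) ℂ))
    (hμ : IsProbabilityMeasure 𝒟.μ) {m : ℤ} (hP2 : 𝒟.CharacterCoefficient m)
    {τ : Fin 2 → ℤ} {ν : Fin 0 → ℤ} {r : ℤ}
    (hEL : Hyp.EischenLiu2024_Sec2_2 2 0 τ ν r 𝒟.Lfac) :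
    0 < (𝒟.zeta (1 / 2)).re ∧ 𝒟.zetaStar (1 / 2) ≠ 0 := by
  have hval := 𝒟.zeta_half_eq_U2 hμ hP2
  have hpos : 0 < (𝒟.zeta (1 / 2)).re := by
    rw [hval, ofReal_re]
    have := 𝒟.normφ_pos
    have := 𝒟.normf_pos
    positivity
  refine ⟨hpos, ?_⟩
  unfold zetaStar
  rw [show (1 / 2 + 1 / 2 : ℂ) = 1 by norm_num]
  exact div_ne_zero (fun h => by rw [h] at hpos; simp at hpos) (Lfac_one_ne_zero hEL)

/-- The radial integrand `½ sinh η · cosh(η/2)^{−6}` is integrable on `(0, ∞)` (the integral p1 evaluates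
to 1/2 converges absolutely): `½ sinh η · cosh(η/2)^{−6} = sinh(η/2) · cosh(η/2)^{−5}` is the
derivative of p1's antiderivative `−(1/2) cosh(η/2)^{−4}`, which tends to 0. -/
theorem integrableOn_radial :
    IntegrableOn (fun η : ℝ => (1 / 2 * Real.sinh η) * Real.cosh (η / 2) ^ (-6 : ℤ))
      (Set.Ioi (0 : ℝ)) volume := by
  have hd := T5CoshIntegral.hasDerivAt_antideriv (1 / 2) 4 (by norm_num) (by norm_num)
  have hI : IntegrableOn (fun η : ℝ => Real.sinh (1 / 2 * η) * Real.cosh (1 / 2 * η) ^ (-(4 + 1) : ℝ))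
      (Set.Ioi (0 : ℝ)) volume :=
    integrableOn_Ioi_deriv_of_nonneg (hd 0).continuousAt.continuousWithinAt (fun x _ => hd x)
      (T5CoshIntegral.integrand_nonneg (1 / 2) 4 (by norm_num))
      (T5CoshIntegral.tendsto_antideriv (1 / 2) 4 (by norm_num) (by norm_num))
  refine hI.congr_fun (fun η _ => ?_) measurableSet_Ioi
  beta_reduce
  have hc : Real.cosh (η / 2) ≠ 0 := (Real.cosh_pos _).ne'
  have h2 : Real.sinh η = 2 * Real.sinh (η / 2) * Real.cosh (η / 2) := by
    rw [← Real.sinh_two_mul]; congr 1; ring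
  rw [show (1 / 2 * η : ℝ) = η / 2 by ring, h2,
    show (-(4 + 1) : ℝ) = ((-5 : ℤ) : ℝ) by norm_num, Real.rpow_intCast,
    show Real.cosh (η / 2) ^ (-5 : ℤ) = Real.cosh (η / 2) * Real.cosh (η / 2) ^ (-6 : ℤ) by
      rw [← zpow_one_add₀ hc]; norm_num]
  ring

/-- THEOREM N4.3 (a), absolute convergence at τ′₂, τ′₃: the integrand of `Z(1/2)` is integrable for the
Haar measure (TIER5 v0.51 ll. 1249–1250 «the absolutely convergent integral»; (N4.3.P2′): «the matrix
coefficient of the forced vector lies in L¹(H_j) ∩ L²(H_j)»). -/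
theorem zeta_integrable_at_half (𝒟 : ArchDoublingDatum H T5UnitaryBound.MemU11)
    (hP2 : 𝒟.FockLineIdentification) (hP2' : 𝒟.LowestWeightCoefficient)
    (hA2f : Hyp.Ruhl1970_A2f 𝒟) :
    Integrable (fun g => 𝒟.coeffW g * (starRingEnd ℂ) (𝒟.coeffπ g)) 𝒟.μ := by
  obtain ⟨c, hc, hmap⟩ := hA2f
  have hnf : 𝒟.normf ≠ 0 := 𝒟.normf_pos.ne'
  have hpt : (fun g => 𝒟.coeffW g * (starRingEnd ℂ) (𝒟.coeffπ g)) =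
      fun g => (((𝒟.normφ ^ 2 * 𝒟.normf ^ 2) * Real.cosh (𝒟.eta g / 2) ^ (-6 : ℤ) : ℝ) : ℂ) := by
    funext g
    rw [𝒟.integrand_eq hP2 g, 𝒟.normSq_coeffπ hP2' g]
    congr 1
    field_simp
  rw [hpt]
  refine Integrable.ofReal ?_
  refine Integrable.const_mul ?_ _
  have hF : Measurable fun η : ℝ => Real.cosh (η / 2) ^ (-6 : ℤ) :=
    ((Real.continuous_cosh.comp (continuous_id.div_const 2)).zpow₀ (-6)
      (fun _ => Or.inl (Real.cosh_pos _).ne')).measurable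
  have h1 : Integrable (fun g => Real.cosh (𝒟.eta g / 2) ^ (-6 : ℤ)) 𝒟.μ ↔
      Integrable (fun η : ℝ => Real.cosh (η / 2) ^ (-6 : ℤ)) (Measure.map 𝒟.eta 𝒟.μ) :=
    (integrable_map_measure hF.aestronglyMeasurable 𝒟.measurable_eta.aemeasurable).symm
  rw [h1, hmap, integrable_smul_measure (ENNReal.ofReal_pos.mpr hc).ne' ENNReal.ofReal_ne_top]
  have h2 : (fun η : ℝ => ENNReal.ofReal (1 / 2 * Real.sinh η)) =
      fun η : ℝ => ((Real.toNNReal (1 / 2 * Real.sinh η) : ℝ≥0) : ℝ≥0∞) := rfl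
  have hmeas : Measurable fun η : ℝ => Real.toNNReal (1 / 2 * Real.sinh η) :=
    (Real.measurable_sinh.const_mul (1 / 2)).real_toNNReal
  rw [h2, integrable_withDensity_iff_integrable_smul hmeas]
  refine integrableOn_radial.congr_fun (fun η hη => ?_) measurableSet_Ioi
  simp only [NNReal.smul_def, smul_eq_mul]
  rw [Real.coe_toNNReal _ (by
    have : 0 < Real.sinh η := Real.sinh_pos_iff.mpr hη
    positivity)]

end ArchDoublingDatum

end Summit.Ventures.HodgeRepro2.T6
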